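import Literature.MeasureTheory.Group.InvariantQuotientProdNormalized
import Literature.MeasureTheory.Group.LatticeCovolumeTransport
import HarnessLib

/-!
# The covolume of a product lattice is the product of the covolumes, and its transport along an isomorphism onto a closed subgroup
(Folland, *A Course in Abstract Harmonic Analysis* (1995), §2.6 Thm. 2.49 ∕ (2.52): product Haar measures and product quotients;
Gelbart, *Automorphic forms on adele groups* (1975), Remark 9.23: `meas(G(γ)_ℚ \ G(γ)_𝔸)` is transport-invariant; the equality sign in
Rogawski, *Automorphic Representations of Unitary Groups in Three Variables* (1990), §3.8 Prop. 3.8.1 (a) p. 27 with §14.5 p. 238: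
`m(I_γ(F) \ I_γ(𝔸)) = m(U(H_a)(F) \ U(H_a)(𝔸)) · m(U(H_b)(F) \ U(H_b)(𝔸))` at a singular semisimple `γ`, `I_γ ≅ U(H_a) × U(H_b)`)

Topic `MeasureTheory/Group`; namespace `Literature.MeasureTheory.Group`.  THEOREMS ONLY (no definition, no instance visible to importers, no
named fact, no `sorry`).  Sequel of ★ `InvariantQuotientProdNormalized` (`(ν₁ ⊗ ν₂)/(ρ₁ ⊗ ρ₂) = (ν₁/ρ₁) ⊠ (ν₂/ρ₂)` with constant `1`) and ★
`LatticeCovolumeTransport` (`covolume_count_eq_of_mulEquiv'`: covolumes of lattices for the COUNTING measure are invariant under isomorphisms of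
topological groups), in the currency of the cell's covolume weights `quotientMeasure Γ count _ ν univ` (★ `UnitaryGroupCovolWeightStable`, ★
`TamagawaSingularMembersLetter` clause (K7-s)):

* §0 counting measures on products: `count_prod_count` — `count ⊗ count = count` on `α × β` (countable, measurable singletons; `count = Σ δ`,
  Mathlib `Measure.prod_sum`, `dirac_prod_dirac`); `map_prodEquiv_count` — Mathlib's `Subgroup.prodEquiv Γ₁ Γ₂ : ↥(Γ₁.prod Γ₂) ≃* Γ₁ × Γ₂` carries
  `count` to `count ⊗ count` (the hypothesis `hρ` of ★ `map_quotientProdHomeomorph_quotientMeasure_prod` for lattices).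
* §1 **`covolume_count_prod`** — for closed countable subgroups `Γᵢ ≤ Gᵢ` (second countable locally compact groups, `count` on `Γᵢ` a Haar measure,
  i.e. `Γᵢ` discrete) and Haar measures `νᵢ`:
  `covol(Γ₁ × Γ₂ ≤ G₁ × G₂; ν₁ ⊗ ν₂) = covol(Γ₁ ≤ G₁; ν₁) · covol(Γ₂ ≤ G₂; ν₂)` — Tonelli WITHOUT constant (★ `lintegral_quotientMeasure_prod_eq_lintegral_lintegral`)
  on the function `1`.
* §2 **`covolume_count_eq_mul_of_mulEquiv_prod`** — TRANSPORT: for an isomorphism of topological groups `e : G₁ × G₂ ≃* C` carrying `Γ₁ × Γ₂` onto a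
  closed subgroup `Λ ≤ C` and `ν₁ ⊗ ν₂` to the Haar measure `ν_C`, `covol(Λ ≤ C; ν_C) = covol(Γ₁; ν₁) · covol(Γ₂; ν₂)` (★ `covolume_count_eq_of_mulEquiv'` ∘ §1);
  `covolume_count_eq_mul_of_mulEquiv_prod'` — the same with the transport read `ν_C = e_* (ν₁ ⊗ ν₂)`.

USE (cell `pub/hodgecm-mathlib`, crux H413 = stmt-HodgeConjecture-24833, road D-T clause (K7-s) of ★ S1′ `TamagawaSingularMembersExist`; census
`CENSUS-DT-K7s.F0P3p03g8.md`): with `C = Z_{U(H)(𝔸)}(γ ⊗ 1)` the adelic centraliser of a non-central singular semisimple rational `γ`, `G₁ × G₂ =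
U(H_a)(𝔸) × U(H_b)(𝔸)` (★ `UnitaryGroup.exists_continuousMulEquiv_centralizer_toAdelic_of_singular`, once docked on rational points), `Λ = U(H)(L⁺) ∩ C`,
`Γᵢ = U(H_•)(L⁺)`: the singular covolume weight of (K7-s) is the product of two unitary covolumes — the currency of the Tamagawa letter
(`τ(U(h) × U(1)) = 2 · 2`, Rogawski's «special case of [Kt₆] Prop. 2», L. 14.5.2 (b) p. 238).  This file is the measure-theoretic equality sign only.

## References
* G. B. Folland, *A Course in Abstract Harmonic Analysis* (1995), §2.6 Thm. 2.49, (2.52) [Folland1995].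
* S. Gelbart, *Automorphic forms on adele groups*, Ann. of Math. Stud. 83 (1975), Remark 9.23 p. 155 [Gelbart1975].
* J. D. Rogawski, *Automorphic Representations of Unitary Groups in Three Variables*, Ann. of Math. Stud. 123 (1990), §3.8 Prop. 3.8.1 (a) p. 27;
  §14.5 Lemma 14.5.2 (b) p. 238 [Rogawski1990].
-/

set_option autoImplicit false

noncomputable section

open MeasureTheory MeasureTheory.Measure Topology Set
open scoped ENNReal NNReal

namespace Literature.MeasureTheory.Group

/-! ## §0 Counting measures on products -/

section Count

variable {α β : Type*} [MeasurableSpace α] [MeasurableSpace β]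

/-- **`count ⊗ count = count`** on `α × β` for countable `α`, `β` with measurable singletons: `count = Σ_x δ_x`, the product of sums of
Dirac masses is the sum over pairs of `δ_x ⊗ δ_y = δ_{(x,y)}`. [cite: Folland1995, §2.6 (2.52)] -/
theorem count_prod_count [Countable α] [Countable β] [MeasurableSingletonClass α] [MeasurableSingletonClass β] :
    (count : Measure α).prod (count : Measure β) = (count : Measure (α × β)) := by
  rw [Measure.count, Measure.count, Measure.prod_sum, Measure.count]
  have h : (fun p : α × β => (dirac p.1).prod (dirac p.2)) = fun p : α × β => dirac p := by
    funext p
    rw [dirac_prod_dirac]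
  rw [h]

variable {G₁ G₂ : Type*} [Group G₁] [Group G₂] [MeasurableSpace G₁] [MeasurableSpace G₂]
  (Γ₁ : Subgroup G₁) (Γ₂ : Subgroup G₂)

/-- **`Subgroup.prodEquiv` carries the counting measure of `Γ₁ × Γ₂ ≤ G₁ × G₂` to `count ⊗ count` on `Γ₁ × Γ₂`** (a bijection of countable
spaces with measurable singletons carries `count` to `count`; then `count_prod_count`) — the `hρ` of ★
`map_quotientProdHomeomorph_quotientMeasure_prod` for lattices. [cite: Folland1995, §2.6 (2.52)] [cite: Gelbart1975, Remark 9.23] -/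
theorem map_prodEquiv_count [Countable Γ₁] [Countable Γ₂] [MeasurableSingletonClass Γ₁] [MeasurableSingletonClass Γ₂]
    [MeasurableSingletonClass ↥(Γ₁.prod Γ₂)] :
    Measure.map (Subgroup.prodEquiv Γ₁ Γ₂) (count : Measure ↥(Γ₁.prod Γ₂)) = (count : Measure Γ₁).prod (count : Measure Γ₂) := by
  haveI : Countable ↥(Γ₁.prod Γ₂) := Countable.of_equiv _ (Subgroup.prodEquiv Γ₁ Γ₂).toEquiv.symm
  let φ : ↥(Γ₁.prod Γ₂) ≃ᵐ (Γ₁ × Γ₂) :=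
    { (Subgroup.prodEquiv Γ₁ Γ₂).toEquiv with
      measurable_toFun := measurable_of_countable _
      measurable_invFun := measurable_of_countable _ }
  have hcoe : ⇑(Subgroup.prodEquiv Γ₁ Γ₂) = ⇑φ := rfl
  rw [count_prod_count, hcoe]
  ext s _
  rw [φ.map_apply, ← φ.image_symm, count_injective_image φ.symm.injective]

end Count

/-! ## §1 The covolume of a product lattice -/

section Prod

variable {G₁ G₂ : Type*} [Group G₁] [Group G₂] [TopologicalSpace G₁] [TopologicalSpace G₂]
  [IsTopologicalGroup G₁] [IsTopologicalGroup G₂] [LocallyCompactSpace G₁] [LocallyCompactSpace G₂]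
  [SecondCountableTopology G₁] [SecondCountableTopology G₂] [T2Space G₁] [T2Space G₂]
  [MeasurableSpace G₁] [BorelSpace G₁] [MeasurableSpace G₂] [BorelSpace G₂]
  (Γ₁ : Subgroup G₁) (Γ₂ : Subgroup G₂) [hΓ₁ : IsClosed (Γ₁ : Set G₁)] [hΓ₂ : IsClosed (Γ₂ : Set G₂)]
  [Countable Γ₁] [Countable Γ₂] [MeasurableSingletonClass Γ₁] [MeasurableSingletonClass Γ₂] [MeasurableSingletonClass ↥(Γ₁.prod Γ₂)]
  [(count : Measure Γ₁).IsMulLeftInvariant] [IsFiniteMeasureOnCompacts (count : Measure Γ₁)] [(count : Measure Γ₁).IsOpenPosMeasure]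
  [(count : Measure Γ₁).IsInvInvariant] [SFinite (count : Measure Γ₁)]
  [(count : Measure Γ₂).IsMulLeftInvariant] [IsFiniteMeasureOnCompacts (count : Measure Γ₂)] [(count : Measure Γ₂).IsOpenPosMeasure]
  [(count : Measure Γ₂).IsInvInvariant] [SFinite (count : Measure Γ₂)]
  [(count : Measure ↥(Γ₁.prod Γ₂)).IsMulLeftInvariant] [IsFiniteMeasureOnCompacts (count : Measure ↥(Γ₁.prod Γ₂))]
  [(count : Measure ↥(Γ₁.prod Γ₂)).IsOpenPosMeasure] [(count : Measure ↥(Γ₁.prod Γ₂)).IsInvInvariant] [SFinite (count : Measure ↥(Γ₁.prod Γ₂))]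
  (ν₁ : Measure G₁) [IsHaarMeasure ν₁] [ν₁.IsMulRightInvariant]
  (ν₂ : Measure G₂) [IsHaarMeasure ν₂] [ν₂.IsMulRightInvariant]
  [MeasurableSpace (G₁ ⧸ Γ₁)] [BorelSpace (G₁ ⧸ Γ₁)] [MeasurableSpace (G₂ ⧸ Γ₂)] [BorelSpace (G₂ ⧸ Γ₂)]
  [MeasurableSpace ((G₁ × G₂) ⧸ Γ₁.prod Γ₂)] [BorelSpace ((G₁ × G₂) ⧸ Γ₁.prod Γ₂)]

/-- **The covolume of a product lattice is the product of the covolumes**: for closed discrete countable subgroups `Γᵢ ≤ Gᵢ` and Haar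
measures `νᵢ`, `vol(Γ₁ × Γ₂ \ G₁ × G₂; ν₁ ⊗ ν₂) = vol(Γ₁ \ G₁; ν₁) · vol(Γ₂ \ G₂; ν₂)` — the total masses of the Weil quotient measures
`quotientMeasure Γ count _ ν` (counting measure on the lattice).  Proof: ★ Tonelli without constant for `(ν₁ ⊗ ν₂)/(count ⊗ count)` on the
function `1`. [cite: Folland1995, §2.6 Thm. 2.49, (2.52)] -/
theorem covolume_count_prod :
    quotientMeasure (Γ₁.prod Γ₂) (count : Measure ↥(Γ₁.prod Γ₂)) (isClosed_coe_prod Γ₁ Γ₂ hΓ₁ hΓ₂) (ν₁.prod ν₂) Set.univ =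
      quotientMeasure Γ₁ (count : Measure Γ₁) hΓ₁ ν₁ Set.univ * quotientMeasure Γ₂ (count : Measure Γ₂) hΓ₂ ν₂ Set.univ := by
  have h := lintegral_quotientMeasure_prod_eq_lintegral_lintegral Γ₁ Γ₂ (count : Measure Γ₁) (count : Measure Γ₂)
    (count : Measure ↥(Γ₁.prod Γ₂)) (map_prodEquiv_count Γ₁ Γ₂) ν₁ ν₂ (F := fun _ => (1 : ℝ≥0∞)) measurable_const
  simp only [lintegral_one, lintegral_const] at h
  rw [h, mul_comm]

/-! ## §2 Transport along an isomorphism `G₁ × G₂ ≃* C` onto a closed subgroup -/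

variable {C : Type*} [Group C] [TopologicalSpace C] [IsTopologicalGroup C] [LocallyCompactSpace C] [SecondCountableTopology C] [T2Space C]
  [MeasurableSpace C] [BorelSpace C]
  (e : G₁ × G₂ ≃* C) (he : Continuous e) (hes : Continuous e.symm)
  (Λ : Subgroup C) [hΛ : IsClosed (Λ : Set C)] (hΛe : ∀ g, e g ∈ Λ ↔ g ∈ Γ₁.prod Γ₂)
  [MeasurableSpace (C ⧸ Λ)] [BorelSpace (C ⧸ Λ)] [MeasurableSingletonClass Λ]
  [(count : Measure Λ).IsMulLeftInvariant] [IsFiniteMeasureOnCompacts (count : Measure Λ)] [(count : Measure Λ).IsOpenPosMeasure]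
  [(count : Measure Λ).IsInvInvariant] [SFinite (count : Measure Λ)]
  (νC : Measure C) [IsHaarMeasure νC] [νC.IsMulRightInvariant]

include he hes hΛe in
/-- **Transport of the product covolume**: if `e : G₁ × G₂ ≃* C` is an isomorphism of topological groups carrying the lattice `Γ₁ × Γ₂` onto
the closed subgroup `Λ ≤ C` (`e g ∈ Λ ↔ g ∈ Γ₁ × Γ₂`) and the product Haar measure to `ν_C` (`e_* (ν₁ ⊗ ν₂) = ν_C`), then
`vol(Λ \ C; ν_C) = vol(Γ₁ \ G₁; ν₁) · vol(Γ₂ \ G₂; ν₂)` — ★ `covolume_count_eq_of_mulEquiv'` along `e`, then `covolume_count_prod`.  (At a singular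
semisimple `γ ∈ U(H)(L⁺)`: `m(I_γ(F) \ I_γ(𝔸)) = m(U(H_a)(F) \ U(H_a)(𝔸)) · m(U(H_b)(F) \ U(H_b)(𝔸))`.)
[cite: Gelbart1975, Remark 9.23] [cite: Rogawski1990, §3.8 Prop. 3.8.1 (a) p. 27; §14.5 Lemma 14.5.2 (b) p. 238] -/
theorem covolume_count_eq_mul_of_mulEquiv_prod (hν : Measure.map e (ν₁.prod ν₂) = νC) :
    quotientMeasure Λ (count : Measure Λ) hΛ νC Set.univ =
      quotientMeasure Γ₁ (count : Measure Γ₁) hΓ₁ ν₁ Set.univ * quotientMeasure Γ₂ (count : Measure Γ₂) hΓ₂ ν₂ Set.univ := by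
  haveI : IsClosed ((Γ₁.prod Γ₂ : Subgroup (G₁ × G₂)) : Set (G₁ × G₂)) := isClosed_coe_prod Γ₁ Γ₂ hΓ₁ hΓ₂
  rw [← covolume_count_eq_of_mulEquiv' e he hes (Γ₁.prod Γ₂) Λ hΛe (ν₁.prod ν₂) νC hν]
  exact covolume_count_prod Γ₁ Γ₂ ν₁ ν₂

include he hes hΛe in
/-- The same with the transport hypothesis written `ν_C = e_* (ν₁ ⊗ ν₂)`. [cite: Gelbart1975, Remark 9.23] -/
theorem covolume_count_eq_mul_of_mulEquiv_prod' (hν : νC = Measure.map e (ν₁.prod ν₂)) :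
    quotientMeasure Λ (count : Measure Λ) hΛ νC Set.univ =
      quotientMeasure Γ₁ (count : Measure Γ₁) hΓ₁ ν₁ Set.univ * quotientMeasure Γ₂ (count : Measure Γ₂) hΓ₂ ν₂ Set.univ :=
  covolume_count_eq_mul_of_mulEquiv_prod Γ₁ Γ₂ ν₁ ν₂ e he hes Λ hΛe νC hν.symm

end Prod

end Literature.MeasureTheory.Group
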